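import Literature.MathematicalPhysics.QuantumFieldTheory.Balaban1983to89.B15Prop1MinimiserTowerAxialGauge
import Literature.MathematicalPhysics.QuantumFieldTheory.Balaban1983to89.B15Prop1DatumGaugeNormalisationB
import Literature.MathematicalPhysics.QuantumFieldTheory.Balaban1983to89.B15Prop1RealChartFamilyGaugeTransportB

/-!
# `Balaban1983to89.B15Prop1MinimiserTowerAxialGaugeB` — [Balaban1985RegularSpaces] = «[6]», (1.19) p. 79 (the axial gauge `Ax_k(𝔅_k, U₀)`); [Balaban1985Variational] = «[15]», (4) p. 278
# («u(y) = 1 for y ∈ 𝔅_k»), (16)–(18) p. 280; [Balaban1988Convergent] = «[III]», (2.2) p. 255, (2.10)–(2.13) pp. 256–257, (2.16) p. 257; [Balaban1984PropagatorsII] = «[II]», (2.3) p. 224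
# (the BOND-level determining datum): THE TOWER-AXIAL GAUGE OF THE MINIMISER OVER A BOND DETERMINING SET `𝔅 : BDetSet P` — print-datum ([II] (2.3)) edition of the lane's
# `B15Prop1MinimiserTowerAxialGauge` §1–§4 (the datum-typed declarations N12's junction of record v14ᴸ uses: `toMS_holAtGauge_eq_one`, `gaugeAct_holAtGauge_apply_of_not_mem`,
# `isMinimizer_gaugeAct_of_residual`, `isMinimizer_gaugeAct_holAtGauge_atRecord`, `dist1_gaugeAct_holAtGauge_le_of_not_mem`, `dist1_gaugeAct_holAtGauge_le_of_shadow`) — class (γ)∕STRUCTURAL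
# of dag-n12-c's census-by-declaration v2 (bus [DAGN12C-G35]∕[DAGN12C-G36], 2026-08-30)

Honest framing: statement-level skeleton of published theorems with citation tags; proofs where landed; nothing here is a claim about the
Yang–Mills mass gap.  Cell `pub-ymgap`, seat `pub-ymgap-dag-n12-c` (g36; LANE OWNER N12 = [B15], strategy s1); count-neutral helper of K1⁹ (`stmt-QuantumFields-27364`);
N12 NOT discharged; finite 𝕋⁴ at fixed ε; nothing continuum ∕ OS ∕ mass-gap ∕ Clay.

WHY A SEPARATE EDITION, AND WHAT CHANGES (the (E1)(iii-b) re-attachment, director-ym №338–№358; LOCATED-2 of the lane's census).  The parent's gauge `σ(x) := 𝒰_{U₀}(path x)` and its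
datum-free §1 lemmas (`gaugeAct_holAtGauge_apply_of_last`, `…_apply_eq_one_of_mem`, `holAtGauge_apply_eq_one_of_nil`, `gaugeAct_holAtGauge_apply_of_roots`) are used AS THEY STAND.  What is
keyed on the tree's site-level `𝐁_k(Z) = Bj M₁ Z k` is re-keyed on a bond determining set `𝔅`: the root letter (F2) and `hu` run over `c ∈ 𝔅 j`; minimiser-hood is `IsMinimizerB`
(`B15DeterminingSetsB`), its residual transport is ✓`B15Prop1GaugeRetractionOfGaugeSectionB.agreeOn_gaugeAct_of_residual` + ✓`B15Prop1RealChartFamilyGaugeTransportB.isMinimizer_gaugeAct_of_agreeOn`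
(with the emptiness letter `h𝔅gt : ∀ j, k < j → 𝔅 j = ∅` the parent took from `Bj_of_gt`); and the parent's ONE structural reading — `Bj_zero`: «a bond MEETING `Ω₁(Z)ᶜ` is a `Γ₀`-bond, both
its end-points are roots and it is pinned» — is replaced by the datum-intrinsic `b ∈ 𝔅 0` and, in `Ω₁`-currency, by the BOTH-end-points letter `h𝔅0 : ∀ b, b₋ ∉ Ω₁(Z) → b₊ ∉ Ω₁(Z) →
b ∈ 𝔅 0` (print's [II] (2.3) scale-`0` member at the block union `Ω₁(Z)`: `B15Prop1GradientFromNearValueB.mem_lamDatumP_maxDomT_zero_of_not_mem₂`).  Under print's datum a CROSSING bond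
(one end in `Ω₁(Z)`) is neither a root pair nor pinned: there `U₀^σ(b) = σ(b₋)U₀(b)σ(b₊)⁻¹` with ONE trivial factor, and its nearness to `1` is the business of the interior∕corridor estimate
[15] (16)–(18) (the lane's `B15Prop1GaugeLetterGammaZeroPinB` asks its letter `hL` on the bonds TOUCHING `Ω₁(Z)`).
RE-KEY NOTE for the junction's generator (dag-n12-d): every theorem loses `hk0 : 0 < k` (it served `Bj_zero` only) and gains `(𝔅 : BDetSet P)` (+ `h𝔅0` where `Ω₁` is read, + `h𝔅gt`
where minimiser-hood is transported); `hF2`∕`hu` read `∀ j, j ≤ k → ∀ c ∈ 𝔅 j, …`; `hmin : IsMinimizerB …`; the one-endpoint `hb : b₋ ∉ Ω₁ ∨ b₊ ∉ Ω₁` becomes `hbs : b₋ ∉ Ω₁`, `hbt :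
b₊ ∉ Ω₁` (or `hb : b ∈ 𝔅 0` in the `…_of_mem_zero` forms).  At print's datum `𝔅 := lamBondsSeq (maxDomT ν.M₁ Z) k`: `h𝔅gt := fun j hj => lamBondsSeq_of_gt _ _ hj`,
`h𝔅0 := fun b hs ht => mem_lamDatumP_maxDomT_zero_of_not_mem₂ hM hk0 hk hdiv b hs ht`.

CONTENTS (theorems only; no `def`, no `instance`, no `sorry`; namespace `…B15Prop1MinimiserTowerAxialGaugeB`; `SU(2)` = the lane's group).
* §1ᴮ ★ `toMS_holAtGauge_eq_one` (the `hu` letter over `𝔅`), `gaugeAct_holAtGauge_apply_of_mem_zero` (`b ∈ 𝔅 0` ⇒ `U₀^σ(b) = U₀(b)`), `gaugeAct_holAtGauge_apply_of_not_mem₂` (`h𝔅0`, both ends off).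
* §2ᴮ ★★ `isMinimizer_gaugeAct_of_residual` (`IsMinimizerB`), ★★ `isMinimizer_gaugeAct_holAtGauge_atRecord` (NODE 00's class of record, `h𝔅gt`).
* §3ᴮ ★★ `dist1_gaugeAct_holAtGauge_le_of_mem_zero`, ★★ `dist1_gaugeAct_holAtGauge_le_of_not_mem₂`, `dist1_gaugeAct_holAtGauge_le_of_shadow` (both ends off `Ω₁(Z)`).
* §4ᴮ ★★★ `exists_towerAxialGauge_atRecord` (clauses (i)–(iv) over `𝔅`; (iv) on the bonds with both end-points off `Ω₁(Z)`), `norm_gaugeAct_holAtGauge_sub_one_le_of_not_mem₂`.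
HONEST SCOPE: kernel group algebra and bookkeeping of [III] (2.2)∕(2.16) over [II] (2.3); the forest (F1)(F2) and the minimiser are HYPOTHESES; no estimate of [15] (16)–(18) is asserted;
count-neutral; N12 NOT discharged; the YM mass gap (Clay) is NOT proved by any of this — R4 closes only the conditional finite-𝕋⁴ rung `BalabanLadder.UV`.
-/

noncomputable section

open Set
open scoped Matrix.Norms.L2Operator

namespace Literature.MathematicalPhysics.QuantumFieldTheory.Balaban1983to89.B15Prop1MinimiserTowerAxialGaugeB

open T4Continuum B15DeterminingSets B15DeterminingSetsB GaugeField
open T4CubeChartGnomonic (SU2)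
open B16Sect1Backgrounds (toMS)
open B14.Eq213DetSet (maxDomT)
open B15Prop1MinimiserTowerAxialGauge (gaugeAct_holAtGauge_apply_of_roots gaugeAct_holAtGauge_apply_eq_one_of_mem holAtGauge_apply_eq_one_of_nil)
open B15Prop1GaugeRetractionOfGaugeSectionB (agreeOn_gaugeAct_of_residual)
open B15Prop1RealChartFamilyGaugeTransportB (isMinimizer_gaugeAct_of_agreeOn)
open B15Eq177ValueInvarianceCoDiv (gaugeAct_mem_regMSCoPOfRecord)
open B15Prop1DatumGaugeNormalisationB (dist1_apply_le_of_isMinimizerB_of_mem dist1_apply_le_of_isMinimizerB_of_not_mem₂)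
open Literature.MathematicalPhysics.QuantumFieldTheory.BalabanImbrieJaffe1984to88.BIJ85Eq453GaugeField (qsstarGIter0)

variable {P : Params}

/-! ## §1ᴮ  The root letter `hu` and the root pairs, over a bond determining set -/

section Gauge

/-- ★ **THE ROOT LETTER `hu` OF THE TOWER-AXIAL GAUGE OVER A BOND DETERMINING SET** — [15] (4) *«u(y) = 1 for y ∈ 𝔅_k»*: by (F2) (the block-tower sites `ι_j c₋`, `ι_j c₊` of the
end-points of the members `c ∈ 𝔅 j`, levels `≤ k`, have empty paths) `σ(x) := 𝒰_{U₀}(path x)` is trivial there, scale by scale — the binder `hu` of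
✓`B15Prop1GaugeRetractionOfGaugeSectionB.agreeOn_gaugeAct_of_residual` ∕ ✓`B15Prop1RealChartFamilyAtGaugeB.exists_realChartFamily_atGauge_atRecord`.
[cite: Balaban1985Variational, (4) p.278; Balaban1988Convergent, (2.10) p.256; Balaban1984PropagatorsII, (2.3) p.224] -/
theorem toMS_holAtGauge_eq_one (path : Site P 0 → List (LStep P 0)) (U₀ : GaugeField P 0 SU2) (𝔅 : BDetSet P) (k : ℕ)
    (hF2 : ∀ j, j ≤ k → ∀ c ∈ 𝔅 j, path (embIter j c.src) = [] ∧ path (embIter j c.tgt) = []) :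
    ∀ j, j ≤ k → ∀ c ∈ 𝔅 j,
      toMS (fun x => holAt U₀ (path x)) j c.src = 1 ∧ toMS (fun x => holAt U₀ (path x)) j c.tgt = 1 := by
  intro j hj c hc
  obtain ⟨hs, ht⟩ := hF2 j hj c hc
  exact ⟨holAtGauge_apply_eq_one_of_nil path U₀ hs, holAtGauge_apply_eq_one_of_nil path U₀ ht⟩

/-- **ON THE SCALE-`0` MEMBERS OF THE DATUM THE TOWER-AXIAL GAUGE DOES NOTHING** (datum-intrinsic): both end-points of `b ∈ 𝔅 0` are root points, hence roots by (F2) at `j = 0`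
(`ι_0 = id`), so `U₀^σ(b) = U₀(b)`. [cite: Balaban1988Convergent, (2.2) p.255, (2.10) p.256; Balaban1985Variational, (4) p.278; Balaban1984PropagatorsII, (2.3) p.224] -/
theorem gaugeAct_holAtGauge_apply_of_mem_zero (path : Site P 0 → List (LStep P 0)) (U₀ : GaugeField P 0 SU2) (𝔅 : BDetSet P) (k : ℕ)
    (hF2 : ∀ j, j ≤ k → ∀ c ∈ 𝔅 j, path (embIter j c.src) = [] ∧ path (embIter j c.tgt) = [])
    {b : PBond P 0} (hb : b ∈ 𝔅 0) :
    gaugeAct (fun x => holAt U₀ (path x)) U₀ b = U₀ b := by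
  obtain ⟨hs, ht⟩ := hF2 0 (Nat.zero_le _) b hb
  exact gaugeAct_holAtGauge_apply_of_roots path U₀ hs ht

/-- **ON THE BONDS WITH BOTH END-POINTS OFF `Ω₁(Z)` THE TOWER-AXIAL GAUGE DOES NOTHING** (`Ω₁`-currency, through the letter `h𝔅0`: such bonds are scale-`0` members of the datum —
print's `Λ₀` at the block union `Ω₁(Z)`).  The parent's one-endpoint hypothesis is NOT sufficient: a crossing bond has only ONE root end-point.
[cite: Balaban1988Convergent, (2.2) p.255, (2.10) p.256; Balaban1985Variational, (4) p.278; Balaban1984PropagatorsII, (2.3) p.224] -/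
theorem gaugeAct_holAtGauge_apply_of_not_mem₂ (path : Site P 0 → List (LStep P 0)) (U₀ : GaugeField P 0 SU2) (M₁ : ℕ) (Z : Set (Site P 0))
    (𝔅 : BDetSet P) (k : ℕ)
    (h𝔅0 : ∀ b : PBond P 0, b.src ∉ maxDomT M₁ Z 1 → b.tgt ∉ maxDomT M₁ Z 1 → b ∈ 𝔅 0)
    (hF2 : ∀ j, j ≤ k → ∀ c ∈ 𝔅 j, path (embIter j c.src) = [] ∧ path (embIter j c.tgt) = [])
    {b : PBond P 0} (hbs : b.src ∉ maxDomT M₁ Z 1) (hbt : b.tgt ∉ maxDomT M₁ Z 1) :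
    gaugeAct (fun x => holAt U₀ (path x)) U₀ b = U₀ b :=
  gaugeAct_holAtGauge_apply_of_mem_zero path U₀ 𝔅 k hF2 (h𝔅0 b hbs hbt)

end Gauge

/-! ## §2ᴮ  `U₀^σ` is a (2.12) minimiser of the same data, over a bond determining set -/

section Minimiser

/-- ★★ **A RESIDUAL GAUGE KEEPS MINIMISER-HOOD — BOND-DATUM EDITION** (any `SU(2)` averaging family, any class invariant under `σ`): if `σ` carries the root letter `hu` at `𝔅` (levels
`≤ k ≤ m + K`, `𝔅 j = ∅` above `k`), then `U₀^σ` realises the same multi-scale data as `U₀` on `𝔅` (✓`…GaugeRetractionOfGaugeSectionB.agreeOn_gaugeAct_of_residual`) and, being in the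
class with the same action, is a (2.12) minimiser of the same problem whenever `U₀` is (✓`…RealChartFamilyGaugeTransportB.isMinimizer_gaugeAct_of_agreeOn`).
[cite: Balaban1988Convergent, (2.12) p.256; Balaban1985Variational, (4) p.278, (181) p.307; Balaban1984PropagatorsII, (2.3) p.224] -/
theorem isMinimizer_gaugeAct_of_residual (av : ∀ j, Averaging P j SU2) {reg : Set (GaugeField P 0 SU2)} (𝔅 : BDetSet P) {k : ℕ}
    (hk : k ≤ P.m + P.K) (h𝔅gt : ∀ j, k < j → 𝔅 j = ∅) {σ : GaugeTransf P 0 SU2}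
    (hu : ∀ j, j ≤ k → ∀ b ∈ 𝔅 j, toMS σ j b.src = 1 ∧ toMS σ j b.tgt = 1)
    (hreg : ∀ U, U ∈ reg → gaugeAct σ U ∈ reg) {V : MSField P SU2} {U₀ : GaugeField P 0 SU2} (hmin : IsMinimizerB av reg 𝔅 V U₀) :
    IsMinimizerB av reg 𝔅 V (gaugeAct σ U₀) :=
  isMinimizer_gaugeAct_of_agreeOn av σ (hreg U₀ hmin.1) (agreeOn_gaugeAct_of_residual av 𝔅 hk h𝔅gt hu U₀) hmin

/-- ★★ **AT NODE 00's CLASS OF RECORD** (`regMSCoPOfRecord F 2 ν Kt k (maxDomT ν.M₁ Z)`, gauge invariant by `B15Eq177ValueInvarianceCoDiv.gaugeAct_mem_regMSCoPOfRecord`; the datum lives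
at levels `≤ k`, `h𝔅gt`): the tower-axial gauge of a rooted forest with (F2) at `𝔅` carries a (2.12) minimiser `U₀` of `𝔅` to the minimiser `U₀^σ` of the same data.
[cite: Balaban1988Convergent, (2.12) p.256; Balaban1985Variational, (4) p.278; Balaban1984PropagatorsII, (2.3) p.224] -/
theorem isMinimizer_gaugeAct_holAtGauge_atRecord {F : T4Family} (ν : Node00.Stage7Numerics) (Kt : ℕ) {k : ℕ} (hk : k ≤ (F.P Kt).m + (F.P Kt).K)
    (Z : Set (Site (F.P Kt) 0)) (𝔅 : BDetSet (F.P Kt)) (h𝔅gt : ∀ j, k < j → 𝔅 j = ∅)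
    (path : Site (F.P Kt) 0 → List (LStep (F.P Kt) 0)) (U₀ : GaugeField (F.P Kt) 0 SU2)
    (hF2 : ∀ j, j ≤ k → ∀ c ∈ 𝔅 j, path (embIter j c.src) = [] ∧ path (embIter j c.tgt) = [])
    {V : MSField (F.P Kt) SU2}
    (hmin : IsMinimizerB (Node00.avOfRecord F 2 Kt) (Node00.regMSCoPOfRecord F 2 ν Kt k (maxDomT ν.M₁ Z)) 𝔅 V U₀) :
    IsMinimizerB (Node00.avOfRecord F 2 Kt) (Node00.regMSCoPOfRecord F 2 ν Kt k (maxDomT ν.M₁ Z)) 𝔅 V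
      (gaugeAct (fun x => holAt U₀ (path x)) U₀) :=
  isMinimizer_gaugeAct_of_residual (Node00.avOfRecord F 2 Kt) 𝔅 hk h𝔅gt
    (toMS_holAtGauge_eq_one path U₀ 𝔅 k hF2)
    (fun U hU => gaugeAct_mem_regMSCoPOfRecord ν Kt k (maxDomT ν.M₁ Z) _ U hU) hmin

end Minimiser

/-! ## §3ᴮ  The pinned half of the localised near-flatness at `U₀^σ`, over a bond determining set -/

section Pinned

open B14.Eq22Determines (blockIter)

/-- ★★ **THE PINNED HALF OF `hU` AT THE GAUGED MINIMISER — DATUM-INTRINSIC FORM**: for the tower-axial gauge of a rooted forest with (F2) at `𝔅`, a (2.12) minimiser `U₀` of the data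
`M˙(Q_k^{s*}W)` on `𝔅` (`k ≤ m + K`), and a scale-`0` member `b ∈ 𝔅 0`: `U₀^σ(b) = U₀(b)` is `1` or the shadow value `W⟨B^k b₋, μ(b)⟩`, so `dist1 (U₀^σ b) ≤ δ` as soon as the shadow is
`δ`-near `1` (`0 ≤ δ`; `B15Prop1DatumGaugeNormalisationB.dist1_apply_le_of_isMinimizerB_of_mem`). [cite: Balaban1988Convergent, (2.12)–(2.13) pp.256–257, (2.16) p.257; Balaban1984PropagatorsII, (2.3) p.224] -/
theorem dist1_gaugeAct_holAtGauge_le_of_mem_zero (av : ∀ j, Averaging P j SU2) (reg : Set (GaugeField P 0 SU2))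
    {k : ℕ} (hk : k ≤ P.m + P.K) (𝔅 : BDetSet P) (path : Site P 0 → List (LStep P 0))
    (hF2 : ∀ j, j ≤ k → ∀ c ∈ 𝔅 j, path (embIter j c.src) = [] ∧ path (embIter j c.tgt) = [])
    (W : GaugeField P k SU2) {U₀ : GaugeField P 0 SU2} (hmin : IsMinimizerB av reg 𝔅 (avgFamily av (qsstarGIter0 k W)) U₀)
    {δ : ℝ} (hδ : 0 ≤ δ) {b : PBond P 0} (hb : b ∈ 𝔅 0)
    (hW : B14.Eq22Determines.blockIter k b.tgt ≠ B14.Eq22Determines.blockIter k b.src →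
      dist1 (W ⟨B14.Eq22Determines.blockIter k b.src, b.dir⟩) ≤ δ) :
    dist1 (gaugeAct (fun x => holAt U₀ (path x)) U₀ b) ≤ δ := by
  rw [gaugeAct_holAtGauge_apply_of_mem_zero path U₀ 𝔅 k hF2 hb]
  exact dist1_apply_le_of_isMinimizerB_of_mem av reg hk W 𝔅 hmin hδ hb hW

/-- ★★ **THE PINNED HALF OF `hU` AT THE GAUGED MINIMISER ON THE BONDS WITH BOTH END-POINTS OFF `Ω₁(Z)`** (`Ω₁`-currency, through `h𝔅0`).  With `W = Ṽ_k^{ũ}` normalised on a region box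
containing the shadows this is the Γ₀-part of the lane's localised letter; the crossing bonds are NOT covered (they belong to the interior letter).
[cite: Balaban1988Convergent, (2.2) p.255, (2.12)–(2.13) pp.256–257, (2.16) p.257; Balaban1984PropagatorsII, (2.3) p.224] -/
theorem dist1_gaugeAct_holAtGauge_le_of_not_mem₂ (av : ∀ j, Averaging P j SU2) (reg : Set (GaugeField P 0 SU2)) (M₁ : ℕ) (Z : Set (Site P 0))
    {k : ℕ} (hk : k ≤ P.m + P.K) (𝔅 : BDetSet P)
    (h𝔅0 : ∀ b : PBond P 0, b.src ∉ maxDomT M₁ Z 1 → b.tgt ∉ maxDomT M₁ Z 1 → b ∈ 𝔅 0)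
    (path : Site P 0 → List (LStep P 0))
    (hF2 : ∀ j, j ≤ k → ∀ c ∈ 𝔅 j, path (embIter j c.src) = [] ∧ path (embIter j c.tgt) = [])
    (W : GaugeField P k SU2) {U₀ : GaugeField P 0 SU2} (hmin : IsMinimizerB av reg 𝔅 (avgFamily av (qsstarGIter0 k W)) U₀)
    {δ : ℝ} (hδ : 0 ≤ δ) {b : PBond P 0} (hbs : b.src ∉ maxDomT M₁ Z 1) (hbt : b.tgt ∉ maxDomT M₁ Z 1)
    (hW : B14.Eq22Determines.blockIter k b.tgt ≠ B14.Eq22Determines.blockIter k b.src →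
      dist1 (W ⟨B14.Eq22Determines.blockIter k b.src, b.dir⟩) ≤ δ) :
    dist1 (gaugeAct (fun x => holAt U₀ (path x)) U₀ b) ≤ δ :=
  dist1_gaugeAct_holAtGauge_le_of_mem_zero av reg hk 𝔅 path hF2 W hmin hδ (h𝔅0 b hbs hbt) hW

/-- The set form: the shadows of the block-crossing bonds of a neighbourhood `𝒩` with both end-points off `Ω₁(Z)` lie in a set `𝒞` where `W` is `δ`-near `1`.
[cite: Balaban1988Convergent, (2.2) p.255, (2.16) p.257; Balaban1984PropagatorsII, (2.3) p.224] -/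
theorem dist1_gaugeAct_holAtGauge_le_of_shadow (av : ∀ j, Averaging P j SU2) (reg : Set (GaugeField P 0 SU2)) (M₁ : ℕ) (Z : Set (Site P 0))
    {k : ℕ} (hk : k ≤ P.m + P.K) (𝔅 : BDetSet P)
    (h𝔅0 : ∀ b : PBond P 0, b.src ∉ maxDomT M₁ Z 1 → b.tgt ∉ maxDomT M₁ Z 1 → b ∈ 𝔅 0)
    (path : Site P 0 → List (LStep P 0))
    (hF2 : ∀ j, j ≤ k → ∀ c ∈ 𝔅 j, path (embIter j c.src) = [] ∧ path (embIter j c.tgt) = [])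
    (W : GaugeField P k SU2) {U₀ : GaugeField P 0 SU2} (hmin : IsMinimizerB av reg 𝔅 (avgFamily av (qsstarGIter0 k W)) U₀)
    {δ : ℝ} (hδ : 0 ≤ δ) {𝒞 : Set (PBond P k)} (h𝒞 : ∀ c ∈ 𝒞, dist1 (W c) ≤ δ) {𝒩 : Set (PBond P 0)}
    (hshadow : ∀ b ∈ 𝒩, b.src ∉ maxDomT M₁ Z 1 → b.tgt ∉ maxDomT M₁ Z 1 →
      B14.Eq22Determines.blockIter k b.tgt ≠ B14.Eq22Determines.blockIter k b.src →
      (⟨B14.Eq22Determines.blockIter k b.src, b.dir⟩ : PBond P k) ∈ 𝒞)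
    {b : PBond P 0} (hb𝒩 : b ∈ 𝒩) (hbs : b.src ∉ maxDomT M₁ Z 1) (hbt : b.tgt ∉ maxDomT M₁ Z 1) :
    dist1 (gaugeAct (fun x => holAt U₀ (path x)) U₀ b) ≤ δ :=
  dist1_gaugeAct_holAtGauge_le_of_not_mem₂ av reg M₁ Z hk 𝔅 h𝔅0 path hF2 W hmin hδ hbs hbt fun h => h𝒞 _ (hshadow b hb𝒩 hbs hbt h)

end Pinned

/-! ## §4ᴮ  At the endpoint's objects: the tower-axial gauge of a minimiser over a bond datum, all four clauses -/

section Record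

open B14.Eq22Determines (blockIter)

/-- ★★★ **THE TOWER-AXIAL GAUGE OF A (2.12) MINIMISER AT THE RECORD — BOND-DATUM EDITION.**  Objects: the averaging of record `Node00.avOfRecord F 2 Kt`, the class
`regMSCoPOfRecord F 2 ν Kt k (maxDomT ν.M₁ Z)`, a bond determining set `𝔅` of levels `≤ k ≤ m + K` (`h𝔅gt`) whose scale-`0` member contains every bond with both end-points off
`Ω₁(Z)` (`h𝔅0`) — print's [II] (2.3) datum at `Z`'s maximal sequence has both —, data `M˙(Q_k^{s*}W)` generated by a `k`-field `W`, a rooted forest `path` with (F1) and (F2) at `𝔅`,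
and a minimiser `U₀`.  Then `σ(x) := 𝒰_{U₀}(path x)` satisfies: (i) the ROOT LETTER `hu` at `𝔅`; (ii) `U₀^σ = 1` on every forest bond; (iii) `U₀^σ` is a minimiser of the SAME data on
`𝔅`; (iv) `U₀^σ = U₀` on every bond with both end-points off `Ω₁(Z)`, and there `dist1 (U₀^σ b) ≤ δ` whenever the corridor shadow `⟨B^k b₋, μ(b)⟩` lies in a set `𝒞` on which `W` is
`δ`-near `1` (`0 ≤ δ`).  The crossing bonds and the interior bonds are NOT treated here ([15] (16)–(18)). [cite: Balaban1985RegularSpaces, (1.19) p.79; Balaban1985Variational, (4) p.278,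
(16)–(18) p.280; Balaban1988Convergent, (2.2) p.255, (2.12) p.256, (2.16) p.257; Balaban1984PropagatorsII, (2.3) p.224] -/
theorem exists_towerAxialGauge_atRecord {F : T4Family} (ν : Node00.Stage7Numerics) (Kt : ℕ) {k : ℕ}
    (hk : k ≤ (F.P Kt).m + (F.P Kt).K) (Z : Set (Site (F.P Kt) 0))
    (𝔅 : BDetSet (F.P Kt)) (h𝔅gt : ∀ j, k < j → 𝔅 j = ∅)
    (h𝔅0 : ∀ b : PBond (F.P Kt) 0, b.src ∉ maxDomT ν.M₁ Z 1 → b.tgt ∉ maxDomT ν.M₁ Z 1 → b ∈ 𝔅 0)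
    (path : Site (F.P Kt) 0 → List (LStep (F.P Kt) 0))
    (hF1 : ∀ x, ∀ s ∈ path x, ∃ x' x'' : Site (F.P Kt) 0, path x'' = path x' ++ [s] ∧
      (s.fwd = true → s.bond.src = x' ∧ s.bond.tgt = x'') ∧ (s.fwd = false → s.bond.src = x'' ∧ s.bond.tgt = x'))
    (hF2 : ∀ j, j ≤ k → ∀ c ∈ 𝔅 j, path (embIter j c.src) = [] ∧ path (embIter j c.tgt) = [])
    (W : GaugeField (F.P Kt) k SU2) {U₀ : GaugeField (F.P Kt) 0 SU2}
    (hmin : IsMinimizerB (Node00.avOfRecord F 2 Kt) (Node00.regMSCoPOfRecord F 2 ν Kt k (maxDomT ν.M₁ Z)) 𝔅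
      (avgFamily (Node00.avOfRecord F 2 Kt) (qsstarGIter0 k W)) U₀)
    {δ : ℝ} (hδ : 0 ≤ δ) {𝒞 : Set (PBond (F.P Kt) k)} (h𝒞 : ∀ c ∈ 𝒞, dist1 (W c) ≤ δ) :
    ∃ σ : GaugeTransf (F.P Kt) 0 SU2,
      (∀ j, j ≤ k → ∀ c ∈ 𝔅 j, toMS σ j c.src = 1 ∧ toMS σ j c.tgt = 1) ∧
      (∀ x, ∀ s ∈ path x, gaugeAct σ U₀ s.bond = 1) ∧
      IsMinimizerB (Node00.avOfRecord F 2 Kt) (Node00.regMSCoPOfRecord F 2 ν Kt k (maxDomT ν.M₁ Z)) 𝔅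
        (avgFamily (Node00.avOfRecord F 2 Kt) (qsstarGIter0 k W)) (gaugeAct σ U₀) ∧
      (∀ b : PBond (F.P Kt) 0, b.src ∉ maxDomT ν.M₁ Z 1 → b.tgt ∉ maxDomT ν.M₁ Z 1 → gaugeAct σ U₀ b = U₀ b) ∧
      ∀ b : PBond (F.P Kt) 0, b.src ∉ maxDomT ν.M₁ Z 1 → b.tgt ∉ maxDomT ν.M₁ Z 1 →
        (B14.Eq22Determines.blockIter k b.tgt ≠ B14.Eq22Determines.blockIter k b.src →
          (⟨B14.Eq22Determines.blockIter k b.src, b.dir⟩ : PBond (F.P Kt) k) ∈ 𝒞) →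
        dist1 (gaugeAct σ U₀ b) ≤ δ :=
  ⟨fun x => holAt U₀ (path x), toMS_holAtGauge_eq_one path U₀ 𝔅 k hF2,
    fun _ _ hs => gaugeAct_holAtGauge_apply_eq_one_of_mem path U₀ hF1 hs,
    isMinimizer_gaugeAct_holAtGauge_atRecord ν Kt hk Z 𝔅 h𝔅gt path U₀ hF2 hmin,
    fun _ hbs hbt => gaugeAct_holAtGauge_apply_of_not_mem₂ path U₀ ν.M₁ Z 𝔅 k h𝔅0 hF2 hbs hbt,
    fun _ hbs hbt hsh => dist1_gaugeAct_holAtGauge_le_of_not_mem₂ (Node00.avOfRecord F 2 Kt) _ ν.M₁ Z hk 𝔅 h𝔅0 path hF2 W hmin hδ hbs hbt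
      fun h => h𝒞 _ (hsh h)⟩

/-- The same with the lane's matrix-norm reading of `dist1` on `SU(2)` (`B15Prop1DatumGaugeNormalisation.dist1_eq_norm_sub_one_su2`): `‖↑(U₀^σ b) − 1‖ ≤ δ` on a bond with both
end-points off `Ω₁(Z)`. [cite: Balaban1985Averaging, (19) p.21; Balaban1988Convergent, (2.2) p.255; Balaban1984PropagatorsII, (2.3) p.224] -/
theorem norm_gaugeAct_holAtGauge_sub_one_le_of_not_mem₂ {F : T4Family} (ν : Node00.Stage7Numerics) (Kt : ℕ) {k : ℕ}
    (hk : k ≤ (F.P Kt).m + (F.P Kt).K) (Z : Set (Site (F.P Kt) 0)) (𝔅 : BDetSet (F.P Kt))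
    (h𝔅0 : ∀ b : PBond (F.P Kt) 0, b.src ∉ maxDomT ν.M₁ Z 1 → b.tgt ∉ maxDomT ν.M₁ Z 1 → b ∈ 𝔅 0)
    (path : Site (F.P Kt) 0 → List (LStep (F.P Kt) 0))
    (hF2 : ∀ j, j ≤ k → ∀ c ∈ 𝔅 j, path (embIter j c.src) = [] ∧ path (embIter j c.tgt) = [])
    (W : GaugeField (F.P Kt) k SU2) {U₀ : GaugeField (F.P Kt) 0 SU2}
    (hmin : IsMinimizerB (Node00.avOfRecord F 2 Kt) (Node00.regMSCoPOfRecord F 2 ν Kt k (maxDomT ν.M₁ Z)) 𝔅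
      (avgFamily (Node00.avOfRecord F 2 Kt) (qsstarGIter0 k W)) U₀)
    {δ : ℝ} (hδ : 0 ≤ δ) {b : PBond (F.P Kt) 0} (hbs : b.src ∉ maxDomT ν.M₁ Z 1) (hbt : b.tgt ∉ maxDomT ν.M₁ Z 1)
    (hW : B14.Eq22Determines.blockIter k b.tgt ≠ B14.Eq22Determines.blockIter k b.src →
      ‖((W ⟨B14.Eq22Determines.blockIter k b.src, b.dir⟩ : SU2) : Matrix (Fin 2) (Fin 2) ℂ) - 1‖ ≤ δ) :
    ‖((gaugeAct (fun x => holAt U₀ (path x)) U₀ b : SU2) : Matrix (Fin 2) (Fin 2) ℂ) - 1‖ ≤ δ :=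
  dist1_gaugeAct_holAtGauge_le_of_not_mem₂ (Node00.avOfRecord F 2 Kt) _ ν.M₁ Z hk 𝔅 h𝔅0 path hF2 W hmin hδ hbs hbt hW

end Record

end Literature.MathematicalPhysics.QuantumFieldTheory.Balaban1983to89.B15Prop1MinimiserTowerAxialGaugeB

end
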